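import Mathlib
import Literature.Analysis.FluidPDE.DuchonRobertShellLaw

/-!
# Flux transfer I: Hölder `(3, 3/2)` toolkit and `L³ × L^{3/2}` continuity of the cubic flux pairing

Part of the flux-transfer package for the crux `ConeDesingularisation ↔ CascadeSoliton`
(stmt-AnomalousDissipation-19034/19036, route `PointSink`); headline and overview in
`…/ConeDesingularisation/Negative/FedConeFlux.lean`.

* §1 Hölder/Young with exponents `(3, 3/2)` for nonnegative real densities;
* §2 `flux_pairing_tendsto`: `∫ (½‖u_k‖² + p_k) w[u_k] → ∫ (½‖V‖² + Π) w[V]` when `u_k → V` in `L³(A)`,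
  `p_k → Π` in `L^{3/2}(A)` on a bounded measurable `A` off which the continuous compactly supported
  test field `w` vanishes. [folklore]
-/

-- `Summit.<Summit>.<Problem>` is the tree's mandated summit-side namespace (CONVENTIONS §2).
set_option linter.dupNamespace false

noncomputable section

namespace Summit.AnomalousDissipation.AnomalousDissipation.Theorems.ConeDesingularisation.Negative

open MeasureTheory Filter Topology Set Metric
open scoped InnerProductSpace ContDiff
open Literature.Analysis.FluidPDE.Torus (add_pow_three_le)

/-! ### §1 Hölder toolkit with exponents `(3, 3/2)` for nonnegative real densities -/

/-- `3` and `3/2` are Hölder conjugate. [folklore] -/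
theorem holderConjugate_three_threeHalves : (3 : ℝ).HolderConjugate (3 / 2) := by
  rw [Real.holderConjugate_iff]; norm_num

/-- Young: `a b ≤ a³/3 + (2/3) b^{3/2}` for `a, b ≥ 0`. [folklore] -/
theorem young_three_threeHalves {a b : ℝ} (ha : 0 ≤ a) (hb : 0 ≤ b) :
    a * b ≤ a ^ 3 / 3 + b ^ (3 / 2 : ℝ) / (3 / 2) := by
  have h := Real.young_inequality_of_nonneg ha hb holderConjugate_three_threeHalves
  have h3 : a ^ (3 : ℝ) = a ^ 3 := by
    rw [show (3 : ℝ) = ((3 : ℕ) : ℝ) by norm_num, Real.rpow_natCast]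
  rwa [h3] at h

/-- **Hölder `(3, 3/2)` for nonnegative densities.** On any measure space, if `f, g ≥ 0` are
a.e.-strongly measurable with `f³` and `g^{3/2}` integrable, then `f g` is integrable and
`∫ f g ≤ (∫ f³)^{1/3} (∫ g^{3/2})^{2/3}`. [folklore] -/
theorem holder_three_threeHalves {α : Type*} [MeasurableSpace α] {μ : Measure α} {f g : α → ℝ}
    (hf0 : ∀ x, 0 ≤ f x) (hg0 : ∀ x, 0 ≤ g x) (hfm : AEStronglyMeasurable f μ)
    (hgm : AEStronglyMeasurable g μ) (hf : Integrable (fun x => f x ^ 3) μ)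
    (hg : Integrable (fun x => g x ^ (3 / 2 : ℝ)) μ) :
    Integrable (fun x => f x * g x) μ ∧
      ∫ x, f x * g x ∂μ ≤ (∫ x, f x ^ 3 ∂μ) ^ (1 / 3 : ℝ) * (∫ x, g x ^ (3 / 2 : ℝ) ∂μ) ^ (2 / 3 : ℝ) := by
  have h3 : ∀ x, f x ^ (3 : ℝ) = f x ^ 3 := fun x => by
    rw [show (3 : ℝ) = ((3 : ℕ) : ℝ) by norm_num, Real.rpow_natCast]
  refine ⟨?_, ?_⟩
  · refine Integrable.mono' ((hf.div_const 3).add (hg.div_const (3 / 2))) (hfm.mul hgm)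
      (Eventually.of_forall fun x => ?_)
    rw [Real.norm_of_nonneg (mul_nonneg (hf0 x) (hg0 x))]
    exact young_three_threeHalves (hf0 x) (hg0 x)
  · have hfL : MemLp f (ENNReal.ofReal 3) μ := by
      refine (integrable_norm_rpow_iff hfm (by simp) ENNReal.ofReal_ne_top).1 ?_
      rw [ENNReal.toReal_ofReal (by norm_num : (0 : ℝ) ≤ 3)]
      refine hf.congr (Eventually.of_forall fun x => ?_)
      simp only [Real.norm_of_nonneg (hf0 x), h3]
    have hgL : MemLp g (ENNReal.ofReal (3 / 2)) μ := by
      refine (integrable_norm_rpow_iff hgm (by simp) ENNReal.ofReal_ne_top).1 ?_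
      rw [ENNReal.toReal_ofReal (by norm_num : (0 : ℝ) ≤ 3 / 2)]
      refine hg.congr (Eventually.of_forall fun x => ?_)
      simp only [Real.norm_of_nonneg (hg0 x)]
    have key := integral_mul_le_Lp_mul_Lq_of_nonneg holderConjugate_three_threeHalves
      (Eventually.of_forall hf0) (Eventually.of_forall hg0) hfL hgL
    simp only [h3] at key
    convert key using 2
    norm_num

/-- `(a + b)^{3/2} ≤ 3 (a^{3/2} + b^{3/2})` for `a, b ≥ 0`. [folklore] -/
theorem add_rpow_threeHalves_le {a b : ℝ} (ha : 0 ≤ a) (hb : 0 ≤ b) :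
    (a + b) ^ (3 / 2 : ℝ) ≤ 3 * (a ^ (3 / 2 : ℝ) + b ^ (3 / 2 : ℝ)) := by
  have hm0 : 0 ≤ max a b := ha.trans (le_max_left _ _)
  have h1 : a + b ≤ 2 * max a b := by
    rcases le_total a b with h | h
    · rw [max_eq_right h]; linarith
    · rw [max_eq_left h]; linarith
  have h2 : (a + b) ^ (3 / 2 : ℝ) ≤ (2 * max a b) ^ (3 / 2 : ℝ) :=
    Real.rpow_le_rpow (add_nonneg ha hb) h1 (by norm_num)
  have h3 : (2 * max a b) ^ (3 / 2 : ℝ) = (2 : ℝ) ^ (3 / 2 : ℝ) * (max a b) ^ (3 / 2 : ℝ) :=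
    Real.mul_rpow (by norm_num) hm0
  have h4 : (2 : ℝ) ^ (3 / 2 : ℝ) ≤ 3 := by
    have h9 : ((2 : ℝ) ^ (3 / 2 : ℝ)) ^ (2 : ℝ) = 8 := by
      rw [← Real.rpow_mul (by norm_num : (0 : ℝ) ≤ 2)]; norm_num
    have h8 : ((2 : ℝ) ^ (3 / 2 : ℝ)) ^ (2 : ℝ) ≤ (3 : ℝ) ^ (2 : ℝ) := by rw [h9]; norm_num
    exact le_of_pow_le_pow_left₀ two_ne_zero (by norm_num)
      (by simpa [Real.rpow_two] using h8)
  have h5 : (max a b) ^ (3 / 2 : ℝ) ≤ a ^ (3 / 2 : ℝ) + b ^ (3 / 2 : ℝ) := by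
    rcases le_total a b with h | h
    · rw [max_eq_right h]; linarith [Real.rpow_nonneg ha (3 / 2 : ℝ)]
    · rw [max_eq_left h]; linarith [Real.rpow_nonneg hb (3 / 2 : ℝ)]
  calc (a + b) ^ (3 / 2 : ℝ) ≤ (2 : ℝ) ^ (3 / 2 : ℝ) * (max a b) ^ (3 / 2 : ℝ) := h2.trans h3.le
    _ ≤ 3 * (a ^ (3 / 2 : ℝ) + b ^ (3 / 2 : ℝ)) :=
        mul_le_mul h4 h5 (Real.rpow_nonneg hm0 _) (by norm_num)

/-! ### §2 The cubic flux pairing passes to `L³ × L^{3/2}` limits -/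

/-- **Pointwise control of the flux density.** For a linear form `w` with `‖w‖ ≤ C`, vectors
`u, V` and scalars `p, Pc`:
`|(½‖u‖² + p) w(u) − (½‖V‖² + Pc) w(V)| ≤ C (3‖u−V‖³ + 3‖u−V‖‖V‖² + |p−Pc|‖u−V‖ + |p−Pc|‖V‖ + |Pc|‖u−V‖)`.
[folklore] -/
theorem flux_density_sub_le {C : ℝ} (hC : 0 ≤ C) {w : EuclideanSpace ℝ (Fin 3) →L[ℝ] ℝ} (hw : ‖w‖ ≤ C) (u V : EuclideanSpace ℝ (Fin 3))
    (p Pc : ℝ) :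
    |(2⁻¹ * ‖u‖ ^ 2 + p) * w u - (2⁻¹ * ‖V‖ ^ 2 + Pc) * w V| ≤
      C * (3 * ‖u - V‖ ^ 3 + 3 * (‖u - V‖ * ‖V‖ ^ 2) + ‖u - V‖ * |p - Pc| + ‖V‖ * |p - Pc| +
        ‖u - V‖ * |Pc|) := by
  set δ := ‖u - V‖ with hδ
  set v := ‖V‖ with hv
  have hδ0 : 0 ≤ δ := norm_nonneg _
  have hv0 : 0 ≤ v := norm_nonneg _
  have hwz : ∀ z : EuclideanSpace ℝ (Fin 3), |w z| ≤ C * ‖z‖ := fun z =>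
    (Real.norm_eq_abs _).symm.le.trans ((w.le_opNorm z).trans (mul_le_mul_of_nonneg_right hw (norm_nonneg _)))
  have hu : ‖u‖ ≤ δ + v := by
    calc ‖u‖ = ‖(u - V) + V‖ := by rw [sub_add_cancel]
      _ ≤ δ + v := norm_add_le _ _
  have hu0 : 0 ≤ ‖u‖ := norm_nonneg _
  have hsq : |‖u‖ ^ 2 - v ^ 2| ≤ δ * (‖u‖ + v) := by
    rw [sq_sub_sq, abs_mul, abs_of_nonneg (add_nonneg hu0 hv0), mul_comm]
    exact mul_le_mul_of_nonneg_right (by rw [hδ, hv]; exact abs_norm_sub_norm_le u V)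
      (add_nonneg hu0 hv0)
  -- the algebraic decomposition
  have hdec : (2⁻¹ * ‖u‖ ^ 2 + p) * w u - (2⁻¹ * ‖V‖ ^ 2 + Pc) * w V =
      2⁻¹ * (‖u‖ ^ 2 * w (u - V) + (‖u‖ ^ 2 - v ^ 2) * w V) +
        ((p - Pc) * w u + Pc * w (u - V)) := by
    rw [map_sub]; ring
  rw [hdec]
  have t1 : |‖u‖ ^ 2 * w (u - V)| ≤ ‖u‖ ^ 2 * (C * δ) := by
    rw [abs_mul, abs_of_nonneg (sq_nonneg _)]
    exact mul_le_mul_of_nonneg_left (hwz _) (sq_nonneg _)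
  have t2 : |(‖u‖ ^ 2 - v ^ 2) * w V| ≤ δ * (‖u‖ + v) * (C * v) := by
    rw [abs_mul]
    exact mul_le_mul hsq (hwz V) (abs_nonneg _) (mul_nonneg hδ0 (add_nonneg hu0 hv0))
  have t3 : |(p - Pc) * w u| ≤ |p - Pc| * (C * ‖u‖) := by
    rw [abs_mul]
    exact mul_le_mul_of_nonneg_left (hwz u) (abs_nonneg _)
  have t4 : |Pc * w (u - V)| ≤ |Pc| * (C * δ) := by
    rw [abs_mul]
    exact mul_le_mul_of_nonneg_left (hwz _) (abs_nonneg _)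
  have hpPc : 0 ≤ |p - Pc| := abs_nonneg _
  have hPc0 : 0 ≤ |Pc| := abs_nonneg _
  calc |2⁻¹ * (‖u‖ ^ 2 * w (u - V) + (‖u‖ ^ 2 - v ^ 2) * w V) + ((p - Pc) * w u + Pc * w (u - V))|
      ≤ |2⁻¹ * (‖u‖ ^ 2 * w (u - V) + (‖u‖ ^ 2 - v ^ 2) * w V)| +
          |(p - Pc) * w u + Pc * w (u - V)| := abs_add_le _ _
    _ ≤ 2⁻¹ * (‖u‖ ^ 2 * (C * δ) + δ * (‖u‖ + v) * (C * v)) +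
          (|p - Pc| * (C * ‖u‖) + |Pc| * (C * δ)) := by
        gcongr
        · rw [abs_mul, abs_of_pos (by norm_num : (0 : ℝ) < 2⁻¹)]
          gcongr
          exact (abs_add_le _ _).trans (add_le_add t1 t2)
        · exact (abs_add_le _ _).trans (add_le_add t3 t4)
    _ ≤ C * (3 * δ ^ 3 + 3 * (δ * v ^ 2) + δ * |p - Pc| + v * |p - Pc| + δ * |Pc|) := by
        have a1 : ‖u‖ ^ 2 * δ ≤ δ ^ 3 + 2 * δ ^ 2 * v + δ * v ^ 2 :=
          (mul_le_mul_of_nonneg_right (pow_le_pow_left₀ hu0 hu 2) hδ0).trans_eq (by ring)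
        have a2 : δ * (‖u‖ + v) * v ≤ δ ^ 2 * v + 2 * (δ * v ^ 2) := by
          have : δ * (‖u‖ + v) * v ≤ δ * (δ + v + v) * v := by gcongr
          exact this.trans_eq (by ring)
        have a3 : |p - Pc| * ‖u‖ ≤ |p - Pc| * (δ + v) := mul_le_mul_of_nonneg_left hu hpPc
        have a4 : δ ^ 2 * v ≤ (δ ^ 3 + δ * v ^ 2) / 2 := by
          nlinarith [mul_nonneg hδ0 (sq_nonneg (δ - v))]
        have key : 2⁻¹ * (‖u‖ ^ 2 * δ + δ * (‖u‖ + v) * v) + (|p - Pc| * ‖u‖ + |Pc| * δ) ≤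
            3 * δ ^ 3 + 3 * (δ * v ^ 2) + δ * |p - Pc| + v * |p - Pc| + δ * |Pc| := by
          nlinarith [a1, a2, a3, a4, pow_nonneg hδ0 3, mul_nonneg hδ0 (sq_nonneg v)]
        have := mul_le_mul_of_nonneg_left key hC
        linarith [this]

/-- Joint continuity of evaluation: `x ↦ w x (u x)` is continuous for continuous `w`, `u`.
[folklore] -/
theorem continuous_clm_eval {w : EuclideanSpace ℝ (Fin 3) → EuclideanSpace ℝ (Fin 3) →L[ℝ] ℝ} (hw : Continuous w) {u : EuclideanSpace ℝ (Fin 3) → EuclideanSpace ℝ (Fin 3)}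
    (hu : Continuous u) : Continuous fun x => w x (u x) :=
  isBoundedBilinearMap_apply.continuous.comp (hw.prodMk hu)

/-- Measurability of evaluation: `x ↦ w x (V x)` is a.e.-strongly measurable for continuous `w`
and a.e.-strongly measurable `V`. [folklore] -/
theorem aestronglyMeasurable_clm_eval {μ : Measure (EuclideanSpace ℝ (Fin 3))} {w : EuclideanSpace ℝ (Fin 3) → EuclideanSpace ℝ (Fin 3) →L[ℝ] ℝ} (hw : Continuous w)
    {V : EuclideanSpace ℝ (Fin 3) → EuclideanSpace ℝ (Fin 3)} (hV : AEStronglyMeasurable V μ) :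
    AEStronglyMeasurable (fun x => w x (V x)) μ :=
  isBoundedBilinearMap_apply.continuous.comp_aestronglyMeasurable (hw.aestronglyMeasurable.prodMk hV)

/-- **The cubic flux pairing passes to `L³ × L^{3/2}` limits.** Let `A ⊆ ℝ³` be bounded and
measurable, `u_k, p_k` continuous, `V ∈ L³(A)`, `Pc ∈ L^{3/2}(A)` (a.e.-strongly measurable on `ℝ³`),
with `∫_A ‖u_k − V‖³ → 0` and `∫_A |p_k − Pc|^{3/2} → 0`, and let `w` be a continuous compactly
supported field of linear forms vanishing off `A`. Then
`∫ (½‖u_k‖² + p_k) w(u_k) → ∫ (½‖V‖² + Pc) w(V)` (Hölder `(3, 3/2)` on `A`). [folklore] -/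
theorem flux_pairing_tendsto {A : Set (EuclideanSpace ℝ (Fin 3))} (hAm : MeasurableSet A) (hAb : Bornology.IsBounded A)
    {u : ℕ → EuclideanSpace ℝ (Fin 3) → EuclideanSpace ℝ (Fin 3)} {p : ℕ → EuclideanSpace ℝ (Fin 3) → ℝ} {V : EuclideanSpace ℝ (Fin 3) → EuclideanSpace ℝ (Fin 3)} {Pc : EuclideanSpace ℝ (Fin 3) → ℝ}
    (hu : ∀ k, Continuous (u k)) (hp : ∀ k, Continuous (p k))
    (hVm : AEStronglyMeasurable V volume) (hPcm : AEStronglyMeasurable Pc volume)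
    (hV3 : IntegrableOn (fun x => ‖V x‖ ^ 3) A volume)
    (hPc32 : IntegrableOn (fun x => |Pc x| ^ (3 / 2 : ℝ)) A volume)
    (hdu : Tendsto (fun k => ∫ x in A, ‖u k x - V x‖ ^ 3) atTop (𝓝 0))
    (hdp : Tendsto (fun k => ∫ x in A, |p k x - Pc x| ^ (3 / 2 : ℝ)) atTop (𝓝 0))
    {w : EuclideanSpace ℝ (Fin 3) → EuclideanSpace ℝ (Fin 3) →L[ℝ] ℝ} (hw : Continuous w) (hwc : HasCompactSupport w)
    (hwA : ∀ x ∉ A, w x = 0) :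
    Tendsto (fun k => ∫ x, (2⁻¹ * ‖u k x‖ ^ 2 + p k x) * w x (u k x)) atTop
      (𝓝 (∫ x, (2⁻¹ * ‖V x‖ ^ 2 + Pc x) * w x (V x))) := by
  -- notation and the reduction to `A`
  set μ : Measure (EuclideanSpace ℝ (Fin 3)) := volume.restrict A with hμ
  haveI : IsFiniteMeasure μ := isFiniteMeasure_restrict.2 hAb.measure_lt_top.ne
  obtain ⟨C₀, hC₀⟩ := hw.bounded_above_of_compact_support hwc
  set C := max C₀ 0 with hC_def
  have hC0 : 0 ≤ C := le_max_right _ _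
  have hC : ∀ x, ‖w x‖ ≤ C := fun x => (hC₀ x).trans (le_max_left _ _)
  set I : ℕ → EuclideanSpace ℝ (Fin 3) → ℝ := fun k x => (2⁻¹ * ‖u k x‖ ^ 2 + p k x) * w x (u k x) with hI
  set J : EuclideanSpace ℝ (Fin 3) → ℝ := fun x => (2⁻¹ * ‖V x‖ ^ 2 + Pc x) * w x (V x) with hJ
  have hred : ∀ F : EuclideanSpace ℝ (Fin 3) → ℝ, (∀ x ∉ A, F x = 0) → ∫ x in A, F x = ∫ x, F x := fun F hF =>
    setIntegral_eq_integral_of_forall_compl_eq_zero fun x hx => hF x hx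
  have hIA : ∀ k, ∀ x ∉ A, I k x = 0 := fun k x hx => by simp [hI, hwA x hx]
  have hJA : ∀ x ∉ A, J x = 0 := fun x hx => by simp [hJ, hwA x hx]
  rw [show (fun k => ∫ x, (2⁻¹ * ‖u k x‖ ^ 2 + p k x) * w x (u k x)) = fun k => ∫ x, I k x ∂μ from
    funext fun k => (hred (I k) (hIA k)).symm,
    show (∫ x, (2⁻¹ * ‖V x‖ ^ 2 + Pc x) * w x (V x)) = ∫ x, J x ∂μ from (hred J hJA).symm]
  -- the densities
  set δ : ℕ → EuclideanSpace ℝ (Fin 3) → ℝ := fun k x => ‖u k x - V x‖ with hδ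
  set v : EuclideanSpace ℝ (Fin 3) → ℝ := fun x => ‖V x‖ with hv
  set ε : ℕ → EuclideanSpace ℝ (Fin 3) → ℝ := fun k x => |p k x - Pc x| with hε
  set ϖ : EuclideanSpace ℝ (Fin 3) → ℝ := fun x => |Pc x| with hϖ
  have hδ0 : ∀ k x, 0 ≤ δ k x := fun k x => norm_nonneg _
  have hv0 : ∀ x, 0 ≤ v x := fun x => norm_nonneg _
  have hε0 : ∀ k x, 0 ≤ ε k x := fun k x => abs_nonneg _
  have hϖ0 : ∀ x, 0 ≤ ϖ x := fun x => abs_nonneg _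
  -- measurability
  have hδm : ∀ k, AEStronglyMeasurable (δ k) μ := fun k =>
    (((hu k).aestronglyMeasurable.sub hVm).norm).restrict
  have hvm : AEStronglyMeasurable v μ := hVm.norm.restrict
  have hεm : ∀ k, AEStronglyMeasurable (ε k) μ := fun k =>
    (continuous_abs.comp_aestronglyMeasurable ((hp k).aestronglyMeasurable.sub hPcm)).restrict
  have hϖm : AEStronglyMeasurable ϖ μ := (continuous_abs.comp_aestronglyMeasurable hPcm).restrict
  -- bounds for the continuous data on the bounded set `A`
  have hKc : IsCompact (closure A) := hAb.isCompact_closure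
  have hbd : ∀ k, ∃ M : ℝ, 0 ≤ M ∧ (∀ x ∈ A, ‖u k x‖ ≤ M) ∧ ∀ x ∈ A, |p k x| ≤ M := by
    intro k
    obtain ⟨M₁, hM₁⟩ := hKc.exists_bound_of_continuousOn (hu k).continuousOn
    obtain ⟨M₂, hM₂⟩ := hKc.exists_bound_of_continuousOn (hp k).continuousOn
    refine ⟨max (max M₁ M₂) 0, le_max_right _ _, fun x hx => ?_, fun x hx => ?_⟩
    · exact (hM₁ x (subset_closure hx)).trans ((le_max_left _ _).trans (le_max_left _ _))
    · exact (Real.norm_eq_abs _).symm.le.trans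
        ((hM₂ x (subset_closure hx)).trans ((le_max_right _ _).trans (le_max_left _ _)))
  have hAe : ∀ᵐ x ∂μ, x ∈ A := ae_restrict_mem hAm
  -- integrability of the powers
  have hv3 : Integrable (fun x => v x ^ 3) μ := hV3
  have hϖ32 : Integrable (fun x => ϖ x ^ (3 / 2 : ℝ)) μ := hPc32
  have hδ3 : ∀ k, Integrable (fun x => δ k x ^ 3) μ := by
    intro k
    obtain ⟨M, hM0, hMu, -⟩ := hbd k
    refine Integrable.mono' ((integrable_const (4 * M ^ 3)).add (hv3.const_mul 4))
      ((hδm k).pow 3) (hAe.mono fun x hx => ?_)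
    rw [Real.norm_of_nonneg (pow_nonneg (hδ0 k x) 3)]
    have h1 : δ k x ≤ M + v x := (norm_sub_le _ _).trans (add_le_add (hMu x hx) le_rfl)
    calc δ k x ^ 3 ≤ (M + v x) ^ 3 := pow_le_pow_left₀ (hδ0 k x) h1 3
      _ ≤ 4 * (M ^ 3 + v x ^ 3) := add_pow_three_le hM0 (hv0 x)
      _ = 4 * M ^ 3 + 4 * v x ^ 3 := by ring
  have hε32 : ∀ k, Integrable (fun x => ε k x ^ (3 / 2 : ℝ)) μ := by
    intro k
    obtain ⟨M, hM0, -, hMp⟩ := hbd k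
    refine Integrable.mono' ((integrable_const (3 * M ^ (3 / 2 : ℝ))).add (hϖ32.const_mul 3))
      ((continuous_id.rpow_const fun _ => Or.inr (by norm_num)).comp_aestronglyMeasurable (hεm k))
      (hAe.mono fun x hx => ?_)
    rw [Real.norm_of_nonneg (Real.rpow_nonneg (hε0 k x) _)]
    have h1 : ε k x ≤ M + ϖ x := (abs_sub _ _).trans (add_le_add (hMp x hx) le_rfl)
    calc ε k x ^ (3 / 2 : ℝ) ≤ (M + ϖ x) ^ (3 / 2 : ℝ) :=
          Real.rpow_le_rpow (hε0 k x) h1 (by norm_num)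
      _ ≤ 3 * (M ^ (3 / 2 : ℝ) + ϖ x ^ (3 / 2 : ℝ)) := add_rpow_threeHalves_le hM0 (hϖ0 x)
      _ = 3 * M ^ (3 / 2 : ℝ) + 3 * ϖ x ^ (3 / 2 : ℝ) := by ring
  have hv2_32 : Integrable (fun x => (v x ^ 2) ^ (3 / 2 : ℝ)) μ := by
    refine hv3.congr (Eventually.of_forall fun x => ?_)
    show v x ^ 3 = (v x ^ 2) ^ (3 / 2 : ℝ)
    rw [← Real.rpow_natCast (v x) 2, ← Real.rpow_mul (hv0 x)]
    norm_num
  -- the four Hölder pairings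
  have H1 := fun k => holder_three_threeHalves (μ := μ) (hδ0 k) (fun x => sq_nonneg (v x)) (hδm k)
    (hvm.pow 2) (hδ3 k) hv2_32
  have H2 := fun k => holder_three_threeHalves (μ := μ) (hδ0 k) (hε0 k) (hδm k) (hεm k) (hδ3 k)
    (hε32 k)
  have H3 := fun k => holder_three_threeHalves (μ := μ) hv0 (hε0 k) hvm (hεm k) hv3 (hε32 k)
  have H4 := fun k => holder_three_threeHalves (μ := μ) (hδ0 k) hϖ0 (hδm k) hϖm (hδ3 k) hϖ32
  have hv2int : ∫ x, (v x ^ 2) ^ (3 / 2 : ℝ) ∂μ = ∫ x, v x ^ 3 ∂μ :=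
    integral_congr_ae (Eventually.of_forall fun x => by
      show (v x ^ 2) ^ (3 / 2 : ℝ) = v x ^ 3
      rw [← Real.rpow_natCast (v x) 2, ← Real.rpow_mul (hv0 x)]
      norm_num)
  -- integrability of the flux densities
  have hIint : ∀ k, Integrable (I k) μ := fun k =>
    ((((((hu k).norm.pow 2).const_smul (2⁻¹ : ℝ)).add (hp k)).mul
      (continuous_clm_eval hw (hu k))).integrable_of_hasCompactSupport
      (hwc.mono' fun x hx => by
        by_contra h
        exact hx (by simp [image_eq_zero_of_notMem_tsupport h]))).restrict
  have hJm : AEStronglyMeasurable J μ :=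
    (((hVm.norm.pow 2).const_smul (2⁻¹ : ℝ)).add hPcm).restrict.mul
      (aestronglyMeasurable_clm_eval hw hVm.restrict)
  have H5 := holder_three_threeHalves (μ := μ) hv0 hϖ0 hvm hϖm hv3 hϖ32
  have hwz : ∀ x (z : EuclideanSpace ℝ (Fin 3)), |w x z| ≤ C * ‖z‖ := fun x z => (Real.norm_eq_abs _).symm.le.trans
    (((w x).le_opNorm z).trans (mul_le_mul_of_nonneg_right (hC x) (norm_nonneg _)))
  have hJint : Integrable J μ := by
    refine Integrable.mono' ((hv3.const_mul (C * 2⁻¹)).add (H5.1.const_mul C)) hJm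
      (Eventually.of_forall fun x => ?_)
    rw [Real.norm_eq_abs]
    show |(2⁻¹ * v x ^ 2 + Pc x) * w x (V x)| ≤ C * 2⁻¹ * v x ^ 3 + C * (v x * ϖ x)
    rw [abs_mul]
    calc |2⁻¹ * v x ^ 2 + Pc x| * |w x (V x)| ≤ (2⁻¹ * v x ^ 2 + ϖ x) * (C * v x) := by
          refine mul_le_mul ((abs_add_le _ _).trans ?_) (hwz x (V x)) (abs_nonneg _)
            (add_nonneg (by positivity) (hϖ0 x))
          rw [abs_of_nonneg (by positivity : (0 : ℝ) ≤ 2⁻¹ * v x ^ 2)]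
      _ = C * 2⁻¹ * v x ^ 3 + C * (v x * ϖ x) := by ring
  -- pointwise control of the difference and its integrable majorant
  have hptw : ∀ k x, |I k x - J x| ≤ C * (3 * δ k x ^ 3 + 3 * (δ k x * v x ^ 2) +
      δ k x * ε k x + v x * ε k x + δ k x * ϖ x) := fun k x =>
    flux_density_sub_le hC0 (hC x) (u k x) (V x) (p k x) (Pc x)
  have hInt5 : ∀ k, ∫ x, C * (3 * δ k x ^ 3 + 3 * (δ k x * v x ^ 2) +
      δ k x * ε k x + v x * ε k x + δ k x * ϖ x) ∂μ =
      C * (3 * (∫ x, δ k x ^ 3 ∂μ) + 3 * (∫ x, δ k x * v x ^ 2 ∂μ) + (∫ x, δ k x * ε k x ∂μ) +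
        (∫ x, v x * ε k x ∂μ) + ∫ x, δ k x * ϖ x ∂μ) := by
    intro k
    have h1 : Integrable (fun x => 3 * δ k x ^ 3) μ := (hδ3 k).const_mul 3
    have h2 : Integrable (fun x => 3 * (δ k x * v x ^ 2)) μ := (H1 k).1.const_mul 3
    have h12 : Integrable (fun x => 3 * δ k x ^ 3 + 3 * (δ k x * v x ^ 2)) μ := h1.add h2
    have h123 : Integrable (fun x => 3 * δ k x ^ 3 + 3 * (δ k x * v x ^ 2) + δ k x * ε k x) μ :=
      h12.add (H2 k).1
    have h1234 : Integrable (fun x => 3 * δ k x ^ 3 + 3 * (δ k x * v x ^ 2) + δ k x * ε k x +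
        v x * ε k x) μ := h123.add (H3 k).1
    rw [integral_const_mul, integral_add h1234 (H4 k).1, integral_add h123 (H3 k).1,
      integral_add h12 (H2 k).1, integral_add h1 h2, integral_const_mul, integral_const_mul]
  have hBint : ∀ k, Integrable (fun x => C * (3 * δ k x ^ 3 + 3 * (δ k x * v x ^ 2) +
      δ k x * ε k x + v x * ε k x + δ k x * ϖ x)) μ := fun k =>
    ((((((hδ3 k).const_mul 3).add ((H1 k).1.const_mul 3)).add (H2 k).1).add (H3 k).1).add
      (H4 k).1).const_mul C
  have hdiff : ∀ k, |(∫ x, I k x ∂μ) - ∫ x, J x ∂μ| ≤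
      C * (3 * (∫ x, δ k x ^ 3 ∂μ) + 3 * (∫ x, δ k x * v x ^ 2 ∂μ) + (∫ x, δ k x * ε k x ∂μ) +
        (∫ x, v x * ε k x ∂μ) + ∫ x, δ k x * ϖ x ∂μ) := fun k => by
    rw [← integral_sub (hIint k) hJint, ← hInt5 k]
    exact (abs_integral_le_integral_abs).trans
      (integral_mono ((hIint k).sub hJint).abs (hBint k) fun x => hptw k x)
  -- Hölder: an explicit majorant tending to zero
  set X : ℝ := ∫ x, v x ^ 3 ∂μ with hX
  set Y : ℝ := ∫ x, ϖ x ^ (3 / 2 : ℝ) ∂μ with hY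
  set d : ℕ → ℝ := fun k => ∫ x, δ k x ^ 3 ∂μ with hd
  set e : ℕ → ℝ := fun k => ∫ x, ε k x ^ (3 / 2 : ℝ) ∂μ with he
  have hmaj : ∀ k, |(∫ x, I k x ∂μ) - ∫ x, J x ∂μ| ≤
      C * (3 * d k + 3 * (d k ^ (1 / 3 : ℝ) * X ^ (2 / 3 : ℝ)) + d k ^ (1 / 3 : ℝ) * e k ^ (2 / 3 : ℝ) +
        X ^ (1 / 3 : ℝ) * e k ^ (2 / 3 : ℝ) + d k ^ (1 / 3 : ℝ) * Y ^ (2 / 3 : ℝ)) := by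
    intro k
    refine (hdiff k).trans (mul_le_mul_of_nonneg_left ?_ hC0)
    have i1 := (H1 k).2
    rw [hv2int] at i1
    linarith [i1, (H2 k).2, (H3 k).2, (H4 k).2]
  have hd0 : Tendsto d atTop (𝓝 0) := hdu
  have he0 : Tendsto e atTop (𝓝 0) := hdp
  have hd13 : Tendsto (fun k => d k ^ (1 / 3 : ℝ)) atTop (𝓝 0) :=
    hd0.rpow_const_nhds_zero (by norm_num)
  have he23 : Tendsto (fun k => e k ^ (2 / 3 : ℝ)) atTop (𝓝 0) :=
    he0.rpow_const_nhds_zero (by norm_num)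
  have hlim : Tendsto (fun k => C * (3 * d k + 3 * (d k ^ (1 / 3 : ℝ) * X ^ (2 / 3 : ℝ)) +
      d k ^ (1 / 3 : ℝ) * e k ^ (2 / 3 : ℝ) + X ^ (1 / 3 : ℝ) * e k ^ (2 / 3 : ℝ) +
      d k ^ (1 / 3 : ℝ) * Y ^ (2 / 3 : ℝ))) atTop (𝓝 0) := by
    have h := (((((hd0.const_mul 3).add ((hd13.mul_const (X ^ (2 / 3 : ℝ))).const_mul 3)).add
      (hd13.mul he23)).add (he23.const_mul (X ^ (1 / 3 : ℝ)))).add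
      (hd13.mul_const (Y ^ (2 / 3 : ℝ)))).const_mul C
    simpa only [mul_zero, zero_mul, add_zero] using h
  refine tendsto_iff_norm_sub_tendsto_zero.2
    (squeeze_zero (fun k => norm_nonneg _) (fun k => ?_) hlim)
  rw [Real.norm_eq_abs]
  exact hmaj k

end Summit.AnomalousDissipation.AnomalousDissipation.Theorems.ConeDesingularisation.Negative
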